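import Literature.AlgebraicGeometry.Deformation.PointedSchemeFunctorOfPoints
import Mathlib.AlgebraicGeometry.AlgClosed.Basic
import Mathlib.LinearAlgebra.Dual.Lemmas
import HarnessLib

/-!
# `T_x X = X(K[ε])_x` at a CLOSED point of a scheme locally of finite type over an algebraically closed field;
# `dim_K T_x X = dim_{κ(x)} 𝔪_x/𝔪_x²`

Layer `Literature/AlgebraicGeometry/Deformation`, namespace `Literature.AlgebraicGeometry.Deformation`.  THEOREMS ONLY (no
definition, no named fact, no instance).  Sequel of ★ `Deformation/PointedSchemeFunctorOfPoints` ([GortzWedhorn2020] (6.4)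
Prop. 6.7 at a `K`-RATIONAL point, rationality carried as an augmentation `π : 𝒪_{X,x} →ₐ[K] K`), supplying the datum `π`
in the two situations the tree meets and the bridge to the `κ(x)`-dimension currency of ★
`Dimension/SmoothRelativeDimensionOfClosedPoints` (E6 of `B-plan/F-census/SOCKETS-F.md` §4 (α)):

* §1 `nonempty_augmentation_of_point` — a `K`-point `p : Spec K → X` over `K` through `x` yields an augmentation (its local
  `K`-algebra map, `pointsOverAtEquiv F x K`); `nonempty_augmentation_of_isClosed` — at a CLOSED point of a `K`-scheme locally
  of finite type over an ALGEBRAICALLY CLOSED `K` (Mathlib `pointOfClosedPoint`, Hilbert's Nullstellensatz) — [GortzWedhorn2020,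
  Cor. 3.36]: closed points of a `k`-scheme l.f.t. are the `k̄`-valued points / have residue field `k` when `k = k̄`;
* §2 `finrank_cotangentSpace_eq_finrank_residueField` — for an augmented local `K`-algebra, `dim_K 𝔪/𝔪² = dim_{κ} 𝔪/𝔪²`
  (`κ = K`, ★ `TangentHom.residueFieldLinearEquiv`), and `finrank_dual_cotangentSpace_eq` (Mathlib `Subspace.dual_finrank_eq`);
* §3 **`nonempty_dualNumberPointsOverAt_equiv_of_isClosed`** — at every closed point `x` of a `K`-scheme l.f.t. over `K = K̄`:
  `X(K[ε])_x ≃ (𝔪_x/𝔪_x²)^∨` ([GortzWedhorn2020] Prop. 6.7 applies since `x ∈ X(K)`), with `finrank_dualNumberTangent_eq`: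
  the target has `K`-dimension `dim_{κ(x)} 𝔪_x/𝔪_x²` (the embedding dimension; `= dim 𝒪_{X,x}` iff `x` is a regular point).

Cell `hodgecm-mathlib` (D-0151): count-neutral capital for the (α) road at `ℂ`-points of `𝓜 ⊗ ℂ` (every closed point rational).
Mathlib searched and used: `pointOfClosedPoint(_comp/_apply)`, `residueFieldIsoBase`, `Subspace.dual_finrank_eq`,
`Module.finrank_mul_finrank`, `Algebra.algebraMap_self`, `Spec.map_id`.  HC_CM is proved only modulo the 7 printed citations until rung 0 closes.

## References
* [GortzWedhorn2020] U. Görtz, T. Wedhorn, *Algebraic Geometry I* (2nd ed. 2020): (6.4) Prop. 6.7; Cor. 3.36; Exercise 3.18.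
* [Mazur1997Deformation] B. Mazur, *An introduction to the deformation theory of Galois representations* (1997), §15.
-/

set_option autoImplicit false

noncomputable section
universe u

open CategoryTheory AlgebraicGeometry IsLocalRing Literature.RingTheory.CompleteLocalRings
open scoped DualNumber

namespace Literature.AlgebraicGeometry.Deformation

variable {K : Type u} [Field K] {X : Scheme.{u}} (F : X ⟶ Spec (.of K)) (x : X)

/-! ## §1 Augmentations: from a `K`-point, and at closed points over an algebraically closed field -/

/-- A `K`-point `p : Spec K → X` over `K` is a `K`-valued point through `p(pt)` over `K` in the sense of
`PointsOverAt` (`p ≫ F = 𝟙 = Spec (K → K)`). [cite: GortzWedhorn2020, (3.4) and Exercise 3.18] -/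
theorem point_comp_eq_Spec_map_algebraMap (p : Spec (.of K) ⟶ X) (hp : p ≫ F = 𝟙 _) :
    p ≫ F = Spec.map (CommRingCat.ofHom (algebraMap K K)) := by
  rw [hp, Algebra.algebraMap_self, CommRingCat.ofHom_id]
  exact (Spec.map_id _).symm

/-- **A `K`-point through `x` yields an augmentation of `𝒪_{X,x}`** (its local `K`-algebra map `𝒪_{X,x} → K`,
`pointsOverAtEquiv F x K`): `x` is `K`-rational. [cite: GortzWedhorn2020, (6.4) Prop. 6.7 and Exercise 3.18] -/
theorem nonempty_augmentation_of_point (p : Spec (.of K) ⟶ X) (hp : p ≫ F = 𝟙 _) (hx : p.base (closedPoint K) = x) :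
    letI := (stalkAlgebraMap F x).toAlgebra
    Nonempty (X.presheaf.stalk x →ₐ[K] K) :=
  ⟨(pointsOverAtEquiv F x K ⟨p, hx, point_comp_eq_Spec_map_algebraMap F p hp⟩).1⟩

/-- **At a CLOSED point of a `K`-scheme locally of finite type over an ALGEBRAICALLY CLOSED field, `𝒪_{X,x}` has an
augmentation** (the `K`-point `pointOfClosedPoint` of Mathlib through `x`; Hilbert's Nullstellensatz: `κ(x) = K`).
[cite: GortzWedhorn2020, Cor. 3.36] -/
theorem nonempty_augmentation_of_isClosed [IsAlgClosed K] [LocallyOfFiniteType F] (hx : IsClosed ({x} : Set X)) :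
    letI := (stalkAlgebraMap F x).toAlgebra
    Nonempty (X.presheaf.stalk x →ₐ[K] K) :=
  nonempty_augmentation_of_point F x (pointOfClosedPoint F x hx) (pointOfClosedPoint_comp F x hx)
    (pointOfClosedPoint_apply F x hx _)

/-! ## §2 The `K`-dimension of the cotangent space is its `κ(x)`-dimension -/

section Algebra

variable {A : Type u} [CommRing A] [IsLocalRing A] [Algebra K A]

/-- **`dim_K 𝔪_A/𝔪_A² = dim_{κ(A)} 𝔪_A/𝔪_A²` for an augmented local `K`-algebra** (`K ≃ κ(A)` along the algebra map,
★ `TangentHom.residueFieldLinearEquiv`). [cite: Mazur1997Deformation, §15] -/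
theorem finrank_cotangentSpace_eq_finrank_residueField (π : A →ₐ[K] K) :
    Module.finrank K (CotangentSpace A) = Module.finrank (ResidueField A) (CotangentSpace A) := by
  haveI := TangentHom.isScalarTower_residueField_cotangentSpace (k := K) (A := A)
  have h1 : Module.finrank K (ResidueField A) = 1 := by
    rw [← (TangentHom.residueFieldLinearEquiv π).finrank_eq, Module.finrank_self]
  rw [← Module.finrank_mul_finrank K (ResidueField A) (CotangentSpace A), h1, one_mul]

/-- The dual `(𝔪_A/𝔪_A²)^∨` over `K` has `K`-dimension `dim_{κ(A)} 𝔪_A/𝔪_A²` (Mathlib `Subspace.dual_finrank_eq`).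
[cite: Mazur1997Deformation, §15] -/
theorem finrank_dual_cotangentSpace_eq (π : A →ₐ[K] K) :
    Module.finrank K (Module.Dual K (CotangentSpace A)) = Module.finrank (ResidueField A) (CotangentSpace A) := by
  rw [Subspace.dual_finrank_eq, finrank_cotangentSpace_eq_finrank_residueField π]

end Algebra

/-! ## §3 `T_x X = X(K[ε])_x` at closed points over an algebraically closed field -/

/-- **[GortzWedhorn2020, Prop. 6.7] at a `K`-point:** a `K`-point `p` through `x` gives the bijection
`X(K[ε])_x ≃ (𝔪_x/𝔪_x²)^∨` (`dualNumberPointsOverAtEquivDual` at the augmentation of `p`).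
[cite: GortzWedhorn2020, (6.4) Prop. 6.7] -/
theorem nonempty_dualNumberPointsOverAt_equiv_of_point (p : Spec (.of K) ⟶ X) (hp : p ≫ F = 𝟙 _)
    (hx : p.base (closedPoint K) = x) :
    letI := (stalkAlgebraMap F x).toAlgebra
    Nonempty (PointsOverAt F x K[ε] ≃ Module.Dual K (CotangentSpace (X.presheaf.stalk x))) :=
  letI := (stalkAlgebraMap F x).toAlgebra
  ⟨dualNumberPointsOverAtEquivDual F x (Classical.choice (nonempty_augmentation_of_point F x p hp hx))⟩

/-- **`T_x X = X(K[ε])_x` at every CLOSED point of a `K`-scheme locally of finite type over an algebraically closed `K`:**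
the `K[ε]`-points of `X` over `K` through `x` are in bijection with the dual of the cotangent space `𝔪_x/𝔪_x²`.
[cite: GortzWedhorn2020, (6.4) Prop. 6.7] [cite: GortzWedhorn2020, Cor. 3.36] -/
theorem nonempty_dualNumberPointsOverAt_equiv_of_isClosed [IsAlgClosed K] [LocallyOfFiniteType F]
    (hx : IsClosed ({x} : Set X)) :
    letI := (stalkAlgebraMap F x).toAlgebra
    Nonempty (PointsOverAt F x K[ε] ≃ Module.Dual K (CotangentSpace (X.presheaf.stalk x))) :=
  nonempty_dualNumberPointsOverAt_equiv_of_point F x (pointOfClosedPoint F x hx) (pointOfClosedPoint_comp F x hx)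
    (pointOfClosedPoint_apply F x hx _)

/-- **The `K`-dimension of the tangent space `(𝔪_x/𝔪_x²)^∨` at a closed point is the embedding dimension
`dim_{κ(x)} 𝔪_x/𝔪_x²`** (the currency of ★ `Dimension/SmoothRelativeDimensionOfClosedPoints`), for `X` l.f.t. over `K = K̄`.
[cite: GortzWedhorn2020, (6.4) Prop. 6.7] [cite: GortzWedhorn2020, Cor. 3.36] -/
theorem finrank_dualNumberTangent_eq_of_isClosed [IsAlgClosed K] [LocallyOfFiniteType F] (hx : IsClosed ({x} : Set X)) :
    letI := (stalkAlgebraMap F x).toAlgebra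
    Module.finrank K (Module.Dual K (CotangentSpace (X.presheaf.stalk x))) =
      Module.finrank (ResidueField (X.presheaf.stalk x)) (CotangentSpace (X.presheaf.stalk x)) :=
  letI := (stalkAlgebraMap F x).toAlgebra
  finrank_dual_cotangentSpace_eq (Classical.choice (nonempty_augmentation_of_isClosed F x hx))

end Literature.AlgebraicGeometry.Deformation

end
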